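import Summits.Ventures.DiscreteObjects.UnitDistance.FiniteFieldColouringF23
import Summits.Ventures.DiscreteObjects.UnitDistance.FiniteFieldColouringF31
import Summits.Ventures.DiscreteObjects.UnitDistance.FiniteFieldColouringF43
import Summits.Ventures.DiscreteObjects.UnitDistance.FiniteFieldColouringF47
import HarnessLib

/-!
# Upper sides of the (U) residue-field atlas rows `p = 23, 31, 43, 47` — explicit colourings, one kernel statement

Framing (verbatim for the cell): lottery ticket; floor = certified bounds/negative ranges.

The atlas rows for the primes `p ≡ 3 (mod 4)` between 23 and 47 read `χ(unitCircleGraph (ZMod p)) ≥ 6` by exact SDP certificates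
(udg g4, two-engine, typed in `UnitQuadranceIndependence.lean`; not kernel).  Their UPPER sides are explicit proper colourings found
hub-locally by (equivariant) tabu search (seat udg g8, `code/udg8/equi_tabu.py`) and checked in the kernel in the files imported here:
`χ(UD(F_23²)) ≤ 7`, `χ(UD(F_31²)) ≤ 8`, `χ(UD(F_43²)) ≤ 9`, `χ(UD(F_47²)) ≤ 11`.  No value of `χ(UD(F_p²))` for `p ≥ 23` is in print (cell FRESHNESS-U).  Seat udg g8 (zero farm).
-/

namespace Summit.Ventures.DiscreteObjects.UnitDistance

open SimpleGraph

/-- ATLAS UPPER SIDES (kernel): `χ(UD(F_23²)) ≤ 7`, `χ(UD(F_31²)) ≤ 8`, `χ(UD(F_43²)) ≤ 9`, `χ(UD(F_47²)) ≤ 11`. -/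
theorem atlas_upper_sides_kernel :
    (unitCircleGraph (ZMod 23)).chromaticNumber ≤ 7 ∧
      (unitCircleGraph (ZMod 31)).chromaticNumber ≤ 8 ∧
      (unitCircleGraph (ZMod 43)).chromaticNumber ≤ 9 ∧
      (unitCircleGraph (ZMod 47)).chromaticNumber ≤ 11 :=
  ⟨chromaticNumber_unitCircleGraph_zmod23_le, chromaticNumber_unitCircleGraph_zmod31_le, chromaticNumber_unitCircleGraph_zmod43_le, chromaticNumber_unitCircleGraph_zmod47_le⟩

end Summit.Ventures.DiscreteObjects.UnitDistance
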